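import Mathlib.GroupTheory.Index
import Mathlib.GroupTheory.Subgroup.Centralizer
import Mathlib.FieldTheory.Separable
import Mathlib.Tactic.Group
import HarnessLib

/-!
# R90-TF · S4 «Ch. 13.1–2», (DICT)(1) file F5a — GENERIC COUNTING: the `N(T)`-orbit of a regular point of a torus has `[N(T):T]` elements; fibrewise counting; roots of a split
# separable polynomial are a permutation of the given ones (Rogawski 1990, §12.5 p. 182 «the number of `ν ∈ 𝔇(T∕F)` such that `T^ν` is conjugate to `T″` is `|Ω_F(T)|∕|Ω(T″)|`»)

Cell `hodgecm-mathlib`, crux H413 (`stmt-HodgeConjecture-24833`, lane `--supports … --as helper`), route of record `HCCMUnconditional` (no route verbs; count-neutral).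
Programme R90-TF, section S4 (base `R90-C131`), dealer K2E2-plan (g7), hand (DICT)(1) «`(E¹)³` TYPE», token F5 (the type-(1) rows of ★ `IsFinerCount`); seat R90-C131-p01 (g2).
GENERIC ALGEBRA — no S4 token, Mathlib-only imports; THEOREMS ONLY.

## THE MATHEMATICS
(§1) In a group `G`, let `K = Z(s₀)` be the centraliser of `s₀`.  The map `n ↦ n s₀ n⁻¹` from the normaliser `N(K)` onto the `N(K)`-orbit of `s₀` has fibres the left cosets of
`K ∩ N(K) = K` (as `n₁ s₀ n₁⁻¹ = n₂ s₀ n₂⁻¹ ⟺ n₁⁻¹ n₂ ∈ Z(s₀) = K`), so the orbit has exactly `[N(K) : K]` elements (`Subgroup.index` = `Nat.card` of the coset space; `0` when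
infinite on both sides).  A conjugator between two elements with the same centraliser `K` normalises `K`.  (§2) If every fibre of `f : S → J` has `w` elements (`S, J` finite) then
`|S| = |J| · w`.  (§3) Over a field, if `∏ₗ (X − νₗ) = ∏ₗ (X − uₗ)` with `u` injective (indexed by a finite type), then `ν = u ∘ π` for a permutation `π`.
These are the three counting steps of p. 182: `|{t″ ∈ T″ : t″ ∼_{st} t}| = #{j : T_j = T″} · [N(T″):T″]`.

## CONTENTS
* §1 `natCard_conjOrbit_eq_index`, `mem_normalizer_of_conj_eq_of_centralizer_eq`.
* §2 `natCard_eq_natCard_mul_of_natCard_fiber_eq`.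
* §3 `exists_perm_eq_comp_of_prod_X_sub_C_eq`.

HONEST LABEL: HC_CM is proved only modulo the 7 printed citations (2 remaining named inputs: hLiu418 = stmt-HodgeConjecture-24832, h413 = stmt-HodgeConjecture-24833) until rung 0
closes.  Generic counting for the type-(1) rows of ★ `IsFinerCount` ((DICT)(1) F5b), an input of ★ (B2-S) behind the OPEN (W-NP); discharges no named input.  REL ≠ ★ ≠ BUILT.

## References
* [Rogawski1990] J. D. Rogawski, *Automorphic Representations of Unitary Groups in Three Variables*, Ann. of Math. Stud. 123 (1990), §12.5 p. 182; §3.6 pp. 28–31.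
-/

set_option autoImplicit false
set_option linter.dupNamespace false

open Polynomial

namespace Summit.HodgeConjecture.HodgeConjecture.R90.S4

/-! ## §1 The `N(K)`-orbit of a point with centraliser `K` has `[N(K):K]` elements -/

section Orbit

variable {G : Type*} [Group G]

/-- **`|N(K)·s₀| = [N(K) : K]` for `K = Z(s₀)`**: the number of `N(K)`-conjugates `n s₀ n⁻¹` of an element `s₀` whose centraliser is `K` equals the index of `K` in its
normaliser (both as `Nat.card`, `0` if infinite): `n ↦ n s₀ n⁻¹` is a surjection `N(K) → N(K)·s₀` whose kernel relation is the left-coset relation of `K`.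
[cite: Rogawski1990, §12.5 p. 182] -/
theorem natCard_conjOrbit_eq_index (K : Subgroup G) {s₀ : G} (hK : Subgroup.centralizer ({s₀} : Set G) = K) :
    Nat.card {s : G // ∃ n ∈ Subgroup.normalizer (K : Set G), n * s₀ * n⁻¹ = s} =
      (K.subgroupOf (Subgroup.normalizer (K : Set G))).index := by
  classical
  subst hK
  let φ : ↥(Subgroup.normalizer ((Subgroup.centralizer ({s₀} : Set G)) : Set G)) →
      {s : G // ∃ n ∈ Subgroup.normalizer ((Subgroup.centralizer ({s₀} : Set G)) : Set G), n * s₀ * n⁻¹ = s} :=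
    fun n => ⟨(n : G) * s₀ * (n : G)⁻¹, n, n.2, rfl⟩
  have hφ : Function.Surjective φ := by
    rintro ⟨s, n, hn, rfl⟩
    exact ⟨⟨n, hn⟩, rfl⟩
  have hker : Setoid.ker φ = QuotientGroup.leftRel ((Subgroup.centralizer ({s₀} : Set G)).subgroupOf
      (Subgroup.normalizer ((Subgroup.centralizer ({s₀} : Set G)) : Set G))) := by
    refine Setoid.ext fun a b => ?_
    rw [Setoid.ker_def, QuotientGroup.leftRel_apply, Subgroup.mem_subgroupOf, Subgroup.coe_mul, Subgroup.coe_inv,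
      Subgroup.mem_centralizer_singleton_iff, Subtype.ext_iff]
    constructor
    · intro h
      have h' : (a : G) * s₀ * (a : G)⁻¹ = (b : G) * s₀ * (b : G)⁻¹ := h
      calc (a : G)⁻¹ * (b : G) * s₀ = (a : G)⁻¹ * ((b : G) * s₀ * (b : G)⁻¹) * (b : G) := by group
        _ = (a : G)⁻¹ * ((a : G) * s₀ * (a : G)⁻¹) * (b : G) := by rw [← h']
        _ = s₀ * ((a : G)⁻¹ * (b : G)) := by group
    · intro h
      show (a : G) * s₀ * (a : G)⁻¹ = (b : G) * s₀ * (b : G)⁻¹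
      calc (a : G) * s₀ * (a : G)⁻¹ = (a : G) * (s₀ * ((a : G)⁻¹ * (b : G))) * (b : G)⁻¹ := by group
        _ = (a : G) * ((a : G)⁻¹ * (b : G) * s₀) * (b : G)⁻¹ := by rw [h]
        _ = (b : G) * s₀ * (b : G)⁻¹ := by group
  calc Nat.card {s : G // ∃ n ∈ Subgroup.normalizer ((Subgroup.centralizer ({s₀} : Set G)) : Set G), n * s₀ * n⁻¹ = s}
      = Nat.card (Quotient (Setoid.ker φ)) := Nat.card_congr (Setoid.quotientKerEquivOfSurjective φ hφ).symm
    _ = Nat.card (↥(Subgroup.normalizer ((Subgroup.centralizer ({s₀} : Set G)) : Set G)) ⧸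
          (Subgroup.centralizer ({s₀} : Set G)).subgroupOf (Subgroup.normalizer ((Subgroup.centralizer ({s₀} : Set G)) : Set G))) := by
        rw [hker]; rfl
    _ = _ := rfl

/-- A conjugator between two elements with the same centraliser `K` normalises `K` (`z Z(a) z⁻¹ = Z(z a z⁻¹)`). [cite: Rogawski1990, §12.5 p. 182] -/
theorem mem_normalizer_of_conj_eq_of_centralizer_eq {K : Subgroup G} {a b z : G}
    (ha : Subgroup.centralizer ({a} : Set G) = K) (hb : Subgroup.centralizer ({b} : Set G) = K) (h : z * a * z⁻¹ = b) :
    z ∈ Subgroup.normalizer (K : Set G) := by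
  subst hb
  rw [Subgroup.mem_normalizer_iff]
  intro n
  constructor
  · intro hn
    have hn' : n * a = a * n := Subgroup.mem_centralizer_singleton_iff.1 (ha.symm ▸ hn)
    refine Subgroup.mem_centralizer_singleton_iff.2 ?_
    rw [← h]
    calc z * n * z⁻¹ * (z * a * z⁻¹) = z * (n * a) * z⁻¹ := by group
      _ = z * (a * n) * z⁻¹ := by rw [hn']
      _ = z * a * z⁻¹ * (z * n * z⁻¹) := by group
  · intro hn
    have hn' : z * n * z⁻¹ * b = b * (z * n * z⁻¹) := Subgroup.mem_centralizer_singleton_iff.1 hn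
    rw [← ha]
    refine Subgroup.mem_centralizer_singleton_iff.2 ?_
    have ha' : a = z⁻¹ * b * z := by rw [← h]; group
    rw [ha']
    calc n * (z⁻¹ * b * z) = z⁻¹ * (z * n * z⁻¹ * b) * z := by group
      _ = z⁻¹ * (b * (z * n * z⁻¹)) * z := by rw [hn']
      _ = z⁻¹ * b * z * n := by group

end Orbit

/-! ## §2 Fibrewise counting -/

/-- If every fibre of `f : S → J` (`S`, `J` finite) has exactly `w` elements then `|S| = |J| · w`. [cite: Rogawski1990, §12.5 p. 182] -/
theorem natCard_eq_natCard_mul_of_natCard_fiber_eq {S J : Type*} [Finite S] [Finite J] (f : S → J) (w : ℕ)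
    (hw : ∀ j, Nat.card {s : S // f s = j} = w) : Nat.card S = Nat.card J * w := by
  haveI := Fintype.ofFinite J
  rw [Nat.card_congr (Equiv.sigmaFiberEquiv f).symm, Nat.card_sigma]
  simp_rw [hw]
  rw [Finset.sum_const, Finset.card_univ, smul_eq_mul, Nat.card_eq_fintype_card]

/-! ## §3 Roots of a split separable polynomial -/

/-- **`∏ₗ (X − νₗ) = ∏ₗ (X − uₗ)` with `u` injective ⇒ `ν = u ∘ π` for a permutation `π`** (over a field; finite index type): every `νₗ` is a root of the right-hand side, hence
some `u_{f l}`; `ν` is injective because the product is separable, so `f` is injective, hence bijective. [cite: Rogawski1990, §3.6 p. 30] -/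
theorem exists_perm_eq_comp_of_prod_X_sub_C_eq {K : Type*} [Field K] {ι : Type*} [Fintype ι] [DecidableEq ι] {u ν : ι → K}
    (hu : Function.Injective u) (h : ∏ l, (X - C (ν l)) = ∏ l, (X - C (u l))) : ∃ π : Equiv.Perm ι, ν = u ∘ π := by
  have hroot : ∀ l, ∃ m, ν l = u m := by
    intro l
    have h0 : (∏ m, (X - C (ν m))).eval (ν l) = 0 := by
      rw [eval_prod]
      exact Finset.prod_eq_zero (Finset.mem_univ l) (by rw [eval_sub, eval_X, eval_C, sub_self])
    rw [h, eval_prod, Finset.prod_eq_zero_iff] at h0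
    obtain ⟨m, -, hm⟩ := h0
    rw [eval_sub, eval_X, eval_C, sub_eq_zero] at hm
    exact ⟨m, hm⟩
  choose f hf using hroot
  have hν : Function.Injective ν := separable_prod_X_sub_C_iff.1 (h ▸ separable_prod_X_sub_C_iff.2 hu)
  have hfi : Function.Injective f := fun l l' hll' => hν (by rw [hf l, hf l', hll'])
  refine ⟨Equiv.ofBijective f (Finite.injective_iff_bijective.1 hfi), funext fun l => ?_⟩
  rw [Function.comp_apply, Equiv.ofBijective_apply]
  exact hf l

end Summit.HodgeConjecture.HodgeConjecture.R90.S4
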